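import Mathlib
import Summits.PneNP.PneNP.Theorems.Nc03AvoidResidualCoreReductionBfs

/-!
# Route Nc03AvoidResidualCore, item `ResidualCoreReduction` — BFS on bipartite multigraphs, II: parent edges and the BFS forest

Helper file for `stmt-PneNP-20227` (sequel of `…ReductionBfs`). For an edge set `E` of a bipartite
multigraph `G : Bip ι W`: the least parent edge `pe E w` of a vertex of positive depth (its other
endpoint, `parent E w`, is one level up and on the other side), ancestors `anc E k w`, the deeper
endpoint `deep E j` of an edge, and the BFS forest `forest E` (all parent edges): it lies in `E`,
the parent-edge map is injective, and so the forest has at most `|W|` edges. [folklore]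
-/

set_option linter.dupNamespace false -- `Summit.PneNP.PneNP.…`: summit = sub-problem name (D-0017 single-conjunct layout)

namespace Summit.PneNP.PneNP.Theorems.Nc03Reduction

open Finset

namespace Bip

variable {ι W : Type*} (G : Bip ι W) [LinearOrder W] [Fintype W]

noncomputable section
open Classical

/-- The candidate parent edges of `w`: edges of `E` at `w` whose other endpoint is one level up. -/
def peSet (E : Finset ι) (w : W) : Finset ι :=
  E.filter fun j => w ∈ G.ends j ∧ G.depth E (G.other j w) + 1 = G.depth E w

/-- A vertex of positive depth has a candidate parent edge. -/
theorem peSet_nonempty {E : Finset ι} {w : W} (h : 0 < G.depth E w) : (G.peSet E w).Nonempty := by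
  obtain ⟨u, huw, hdu⟩ := G.exists_up (E := E) (w := w) (k := G.depth E w - 1) (by omega)
  obtain ⟨hne, j, hj, hu, hw⟩ := huw
  refine ⟨j, Finset.mem_filter.2 ⟨hj, hw, ?_⟩⟩
  rw [← G.eq_other hw hu hne, hdu]
  omega

/-- The deeper endpoint of an edge. -/
def deep (E : Finset ι) (j : ι) : W :=
  if G.depth E (G.eA j) < G.depth E (G.eB j) then G.eB j else G.eA j

variable [LinearOrder ι] [Inhabited ι]

/-- The parent edge of `w`: the least candidate (junk at depth `0`). -/
def pe (E : Finset ι) (w : W) : ι :=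
  if h : (G.peSet E w).Nonempty then (G.peSet E w).min' h else default

/-- The parent of `w`: the other endpoint of its parent edge. -/
def parent (E : Finset ι) (w : W) : W := G.other (G.pe E w) w

/-- The parent edge of a vertex of positive depth is a candidate parent edge. -/
theorem pe_mem_peSet {E : Finset ι} {w : W} (h : 0 < G.depth E w) : G.pe E w ∈ G.peSet E w := by
  unfold pe
  rw [dif_pos (G.peSet_nonempty h)]
  exact Finset.min'_mem _ _

/-- The parent edge is the least candidate. -/
theorem pe_le {E : Finset ι} {w : W} (h : 0 < G.depth E w) {j : ι} (hj : j ∈ G.peSet E w) :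
    G.pe E w ≤ j := by
  unfold pe
  rw [dif_pos (G.peSet_nonempty h)]
  exact Finset.min'_le _ _ hj

/-- The parent edge lies in `E`. -/
theorem pe_mem {E : Finset ι} {w : W} (h : 0 < G.depth E w) : G.pe E w ∈ E :=
  (Finset.mem_filter.1 (G.pe_mem_peSet h)).1

/-- The vertex is an endpoint of its parent edge. -/
theorem mem_ends_pe {E : Finset ι} {w : W} (h : 0 < G.depth E w) : w ∈ G.ends (G.pe E w) :=
  (Finset.mem_filter.1 (G.pe_mem_peSet h)).2.1

/-- The parent is one level up. -/
theorem depth_parent {E : Finset ι} {w : W} (h : 0 < G.depth E w) :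
    G.depth E (G.parent E w) + 1 = G.depth E w :=
  (Finset.mem_filter.1 (G.pe_mem_peSet h)).2.2

/-- The parent is an endpoint of the parent edge. -/
theorem parent_mem_ends (E : Finset ι) (w : W) : G.parent E w ∈ G.ends (G.pe E w) :=
  G.other_mem_ends _ _

/-- The endpoints of the parent edge are the vertex and its parent. -/
theorem ends_pe {E : Finset ι} {w : W} (h : 0 < G.depth E w) :
    G.ends (G.pe E w) = {w, G.parent E w} :=
  G.ends_eq_pair (G.mem_ends_pe h)

/-- The parent is adjacent. -/
theorem adj_parent {E : Finset ι} {w : W} (h : 0 < G.depth E w) : G.Adj E (G.parent E w) w :=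
  G.adj_other (G.pe_mem h) (G.mem_ends_pe h)

/-- The parent has the same root. -/
theorem root_parent {E : Finset ι} {w : W} (h : 0 < G.depth E w) :
    G.root E (G.parent E w) = G.root E w :=
  G.root_eq_of_reach (G.adj_parent h).reach

/-- The parent lies on the other side. -/
theorem side_parent {E : Finset ι} {w : W} (h : 0 < G.depth E w) :
    G.side (G.parent E w) = !G.side w := by
  have := G.side_ne_of_adj (G.adj_parent h)
  revert this; cases G.side (G.parent E w) <;> cases G.side w <;> simp

/-- Ancestors: `anc E k w` is the `k`-th parent of `w`. -/
def anc (E : Finset ι) : ℕ → W → W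
  | 0, w => w
  | k + 1, w => G.parent E (anc E k w)

/-- The zeroth ancestor. -/
@[simp] theorem anc_zero (E : Finset ι) (w : W) : G.anc E 0 w = w := rfl

/-- The next ancestor. -/
theorem anc_succ (E : Finset ι) (k : ℕ) (w : W) : G.anc E (k + 1) w = G.parent E (G.anc E k w) := rfl

/-- Depth of ancestors: each step goes one level up (as long as the depth allows). -/
theorem depth_anc {E : Finset ι} {w : W} {k : ℕ} (hk : k ≤ G.depth E w) :
    G.depth E (G.anc E k w) = G.depth E w - k := by
  induction k with
  | zero => simp
  | succ k ih =>
    have h1 := ih (by omega)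
    have hpos : 0 < G.depth E (G.anc E k w) := by rw [h1]; omega
    have h2 := G.depth_parent hpos
    rw [anc_succ]
    omega

/-- Ancestors have the same root. -/
theorem root_anc {E : Finset ι} {w : W} {k : ℕ} (hk : k ≤ G.depth E w) :
    G.root E (G.anc E k w) = G.root E w := by
  induction k with
  | zero => simp
  | succ k ih =>
    have h1 := ih (by omega)
    have hpos : 0 < G.depth E (G.anc E k w) := by rw [G.depth_anc (by omega)]; omega
    rw [anc_succ, G.root_parent hpos, h1]

/-- The ancestor at full depth is the root. -/
theorem anc_depth (E : Finset ι) (w : W) : G.anc E (G.depth E w) w = G.root E w := by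
  have h0 : G.depth E (G.anc E (G.depth E w) w) = 0 := by rw [G.depth_anc le_rfl]; omega
  rw [G.depth_eq_zero_iff.1 h0, G.root_anc le_rfl]

/-- Ancestors at distinct heights (within the depth) are distinct. -/
theorem anc_injOn {E : Finset ι} {w : W} {k k' : ℕ} (hk : k ≤ G.depth E w) (hk' : k' ≤ G.depth E w)
    (h : G.anc E k w = G.anc E k' w) : k = k' := by
  have h1 := G.depth_anc hk
  have h2 := G.depth_anc hk'
  rw [h] at h1
  omega

/-- The deeper endpoint of a parent edge is the child. -/
theorem deep_pe {E : Finset ι} {w : W} (h : 0 < G.depth E w) : G.deep E (G.pe E w) = w := by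
  have hends := G.mem_ends_pe h
  have hd := G.depth_parent h
  unfold deep
  rcases G.mem_ends.1 hends with hw | hw
  · have ho : G.parent E w = G.eB (G.pe E w) := by
      unfold parent other; rw [if_pos hw]
    rw [ho] at hd
    rw [if_neg (by rw [← hw]; omega)]
    exact hw.symm
  · have hne : w ≠ G.eA (G.pe E w) := fun h' => G.eA_ne_eB _ (h'.symm.trans hw)
    have ho : G.parent E w = G.eA (G.pe E w) := by
      unfold parent other; rw [if_neg hne]
    rw [ho] at hd
    rw [if_pos (by rw [← hw]; omega)]
    exact hw.symm

/-- The BFS forest of `E`: the parent edges of the vertices of positive depth. -/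
def forest (E : Finset ι) : Finset ι :=
  (Finset.univ.filter fun w => 0 < G.depth E w).image (G.pe E)

/-- Parent edges are forest edges. -/
theorem pe_mem_forest {E : Finset ι} {w : W} (h : 0 < G.depth E w) : G.pe E w ∈ G.forest E :=
  Finset.mem_image.2 ⟨w, Finset.mem_filter.2 ⟨Finset.mem_univ _, h⟩, rfl⟩

/-- Membership in the forest. -/
theorem mem_forest {E : Finset ι} {j : ι} :
    j ∈ G.forest E ↔ ∃ w, 0 < G.depth E w ∧ G.pe E w = j := by
  simp [forest]

/-- The forest lies in `E`. -/
theorem forest_subset (E : Finset ι) : G.forest E ⊆ E := by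
  intro j hj
  obtain ⟨w, hw, rfl⟩ := G.mem_forest.1 hj
  exact G.pe_mem hw

/-- The parent-edge map is injective on vertices of positive depth. -/
theorem pe_injOn (E : Finset ι) :
    Set.InjOn (G.pe E) ↑(Finset.univ.filter fun w => 0 < G.depth E w) := by
  intro w hw w' hw' h
  have h1 := G.deep_pe (Finset.mem_filter.1 hw).2
  have h2 := G.deep_pe (Finset.mem_filter.1 hw').2
  rw [← h1, ← h2, h]

/-- The forest has at most `|W|` edges. -/
theorem card_forest_le (E : Finset ι) : (G.forest E).card ≤ Fintype.card W := by
  unfold forest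
  rw [Finset.card_image_of_injOn (G.pe_injOn E)]
  exact Finset.card_le_univ _

/-- A forest edge is the parent edge of its deeper endpoint, which has positive depth. -/
theorem forest_eq_pe_deep {E : Finset ι} {j : ι} (hj : j ∈ G.forest E) :
    0 < G.depth E (G.deep E j) ∧ G.pe E (G.deep E j) = j := by
  obtain ⟨w, hw, rfl⟩ := G.mem_forest.1 hj
  rw [G.deep_pe hw]
  exact ⟨hw, rfl⟩

end

end Bip

end Summit.PneNP.PneNP.Theorems.Nc03Reduction
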